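import Summits.CriticalPhenomena.CardyFormulaZ2.Theses.CardyHausdorffMoment
import HarnessLib

/-!
# Birth skeleton `Lines/birth.lean` for the crux `CardyHausdorffMoment.LogConvexApproach`
(item `stmt-CriticalPhenomena-9807`, rank-2 crux of route `route-CriticalPhenomena-CardyHausdorffMoment`,
sub-problem `CardyFormulaZ2`; BC3 skeleton registered by the skeleton registrar
`skel-stmt-CriticalPhenomena-9807`, 2026-08-17)

The crux (Conjecture LC, eventual form): for all integers `1 ≤ q < p` the exactly self-dual hard-way
crossing sequence `a(m) = crossingProb half (p*m) (q*m-1) = P_½(LR([0,pm]×[0,qm−1]))` of bond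
percolation on `ℤ²` at `p = 1/2` is eventually LOG-CONVEX: `a(m+1)² ≤ a(m)·a(m+2)` for `m ≥ N(p,q)`.

## The line: the dyadic counting form of log-convexity at `p = 1/2` (the route's "attack by injection")

At the self-dual point every bond configuration of a box is equally likely, so `a(m)` is a DYADIC
RATIONAL `#Cross / 2^{#edges}`; the edge count of the box `[0,pm]×[0,qm−1]` is the quadratic
`E(m) = 2·pm·(qm−1) + pm + (qm−1)` whose second difference in `m` is EXACTLY `4pq`, so log-convexity
of `a` at index `m+1` is the comparison of cardinalities of explicit finite sets
`2^{4pq} · #Cross_{m+1}² ≤ #Cross_m · #Cross_{m+2}` — the form the route header singles out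
("a purely combinatorial restatement provers can attack by injection": an injection
`Cross_{m+1} × Cross_{m+1} × {0,1}^{4pq} ↪ Cross_m × Cross_{m+2}`, or a multivalued-map / switching
argument, uniform in `m`; every instance is decidable by exact enumeration — the refuters' exact layer,
53 values over 8 families, satisfies it with `N = 1`).  Write, for a box `[0,M]×[0,N] ∩ ℤ²`,

* `E(M,N)` := the lattice edges of `ℤ²` with both endpoints in `rectangle M N`
  (`((rectangle M N ×ˢ rectangle M N).filter (Adj)).image s(·,·)`, the shape used by route
  CardyWickAnisotropy's `DiscNormality` / `RealAxisDictionary`);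
* `C(M,N)` := the number of sub-configurations `ω ⊆ E(M,N)` with `↑ω ∈ lrCrossing M N`
  (an open left-right crossing using only the open edges `ω`).

The three registered stubs (the ONLY `sorry`s of this file):

* `stub_boxEdgeCard` — COMBINATORICS of the grid (provable now; size M): `#E(M,N) = 2MN + M + N`
  (`M(N+1)` horizontal and `(M+1)N` vertical edges).
* `stub_dyadicCount` — FINITE MARGINAL of the product measure (provable now; size M):
  `crossingProb half M N = C(M,N) / 2^{#E(M,N)}`.  Ingredients in the tree: `bondPercolation = prodBernoulli`
  of the indicator weights (`prodBernoulli_indicator_holds`), the crossing event is determined by the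
  pairs of sites of the box (`PlanarDuality.determinedBy_openCrossing`), the cylinder sum
  `RussoPath.prodBernoulli_real_eq_sum_powerset`, and dropping the weight-`0` non-edges
  (`Theorems.sum_powerset_cylinder_eq_of_subset`, CardyWickAnisotropyRealAxisDictionary.lean); at
  `p = 1/2` every cylinder has mass `2^{-#E}`.
* `stub_countingLogConvex` — THE HEART (open; size XL): for all `1 ≤ q < p` there is `N` with
  `2^{4pq} · C(p(m+1), q(m+1)−1)² ≤ C(pm, qm−1) · C(p(m+2), q(m+2)−1)` for all `m ≥ N` (naturals).

Composition `LogConvexApproach_of` (REAL proof, no `sorry`): for `m ≥ max N 1` rewrite the three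
crossing probabilities by `stub_dyadicCount`, the three exponents by `stub_boxEdgeCard`, use the
exponent identity `E(m) + E(m+2) = 2·E(m+1) + 4pq` (`edgeExp_second_diff`, needs `qm ≥ 1`) and the
arithmetic lemma `sq_div_le_of_counts` (`2^k·C₁² ≤ C₀·C₂`, `e₀+e₂ = 2e₁+k` ⟹
`(C₁/2^{e₁})² ≤ (C₀/2^{e₀})·(C₂/2^{e₂})`), both proved below.

Device (D-0027 §3.3, as in `Cruxes/CardyRectangle/Lines/birth.lean`): each stub is a sorried theorem
`Holds.stub_<name> : <full statement over tree declarations>` (registered under the short name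
`stub_<name>` with that text) plus the by-name handle `def stub_<name> : Prop := type_of% Holds.stub_<name>`;
the hypotheses of `LogConvexApproach_of` are exactly the three handles, and `LogConvexApproach_proof`
applies it to the three sorried stubs (certifying mechanically that the handles ARE the stub statements).
Sorries: exactly the three `Holds.stub_*`; nothing else.

Not this line (recorded for the lead): the route's ENGINE avenue — a positive self-adjoint
scale-transfer contraction `S` with `a(N+j) = ‖S^j v‖²` (Keilson 1971: then LC is Cauchy–Schwarz,
`‖S^{j+1}v‖² = ⟨S^j v, S^{j+2} v⟩ ≤ ‖S^j v‖‖S^{j+2}v‖`) — is the foreseen split of the route's OTHER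
crux `HausdorffMomentCrossing` (stmt-9808, strictly stronger; `MomentToLogConvex` stmt-9811 carries it
to this crux) and is deliberately not duplicated here.

Disproof used: none — no `Disproof.lean`, no `Negative/` lemma and no other workfile exists for this
crux at registration (`ledger crux ls stmt-CriticalPhenomena-9807`: "(no workfiles yet)", 2026-08-17);
the negatives index of the summit (11 refuted statements; on this sub-problem stmt-0698
`not_SymmetryUpgrade`, stmt-8581 JunctionShadowing, stmt-0748 degenerate arcs, stmt-6949
DualCurrentTemplate) has no statement about finite-size crossing sequences, box configuration counts
or log-convexity.  No stub is a restatement by triviality: stubs 1–2 contain no inequality in `m` at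
all (true identities, provable now), stub 3 speaks about cardinalities of finite sets and reaches the
crux only through stubs 1–2 and the exponent arithmetic; `stub → LogConvexApproach` /
`stub → CardyFormulaZ2` fail the cheap probes (BC3, see `Lines/birth.md`).
-/

noncomputable section

namespace Summit.CriticalPhenomena.CardyFormulaZ2.Cruxes.LogConvexApproach.Birth

open scoped Classical
open Summit.CriticalPhenomena.CardyFormulaZ2.Theses.CardyHausdorffMoment (LogConvexApproach)

/-! ### The three registered stubs (the ONLY `sorry`s of this file) and their by-name handles -/

/-- **Stub 1 — edge count of a lattice box (combinatorics; provable now, M).** The box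
`[0,M]×[0,N] ∩ ℤ²` (`rectangle M N`) spans exactly `2MN + M + N` edges of `ℤ²`: `M(N+1)` horizontal
and `(M+1)N` vertical ones (Grimmett 1999 §11.3 bookkeeping; Bollobás–Riordan 2006 Ch. 3). -/
protected theorem Holds.stub_boxEdgeCard : ∀ M N : ℕ, (((Literature.Probability.Percolation.rectangle M N ×ˢ Literature.Probability.Percolation.rectangle M N).filter (fun xy ↦ (Literature.Probability.LatticeModels.zdGraph 2).Adj xy.1 xy.2)).image (fun xy ↦ s(xy.1, xy.2))).card = 2 * M * N + M + N := by
  sorry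

/-- By-name handle of the registered stub `Holds.stub_boxEdgeCard`. -/
def stub_boxEdgeCard : Prop := type_of% Holds.stub_boxEdgeCard

/-- **Stub 2 — the dyadic counting formula at `p = 1/2` (finite marginal of the product measure;
provable now, M).** `P_½(LR([0,M]×[0,N])) = #{ω ⊆ E(M,N) : ω crosses} / 2^{#E(M,N)}`: the crossing
event is determined by the edges of the box, each of which is open with probability `1/2`
independently, and non-edges are closed (Grimmett 1999 §1.3, §2.2). -/
protected theorem Holds.stub_dyadicCount : let E : ℕ → ℕ → Finset (Sym2 (Literature.Probability.LatticeModels.Site 2)) := fun M N ↦ ((Literature.Probability.Percolation.rectangle M N ×ˢ Literature.Probability.Percolation.rectangle M N).filter (fun xy ↦ (Literature.Probability.LatticeModels.zdGraph 2).Adj xy.1 xy.2)).image (fun xy ↦ s(xy.1, xy.2)); ∀ M N : ℕ, Literature.Probability.Percolation.crossingProb Literature.Probability.Percolation.half M N = ((((E M N).powerset.filter (fun ω ↦ ((ω : Set (Sym2 (Literature.Probability.LatticeModels.Site 2))) ∈ Literature.Probability.Percolation.lrCrossing M N))).card : ℕ) : ℝ) / 2 ^ (E M N).card := by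
  sorry

/-- By-name handle of the registered stub `Holds.stub_dyadicCount`. -/
def stub_dyadicCount : Prop := type_of% Holds.stub_dyadicCount

/-- **Stub 3 — the heart: eventual log-convexity in counting form (OPEN, XL).** For all integers
`1 ≤ q < p` there is `N` such that for every `m ≥ N`
`2^{4pq} · C(p(m+1), q(m+1)−1)² ≤ C(pm, qm−1) · C(p(m+2), q(m+2)−1)`, where `C(M,N)` counts the
crossing sub-configurations of the edges of the box `[0,M]×[0,N]`; `4pq` is the second difference of
the edge count along the family (the "seam" edges an injection
`Cross_{m+1}² × {0,1}^{4pq} ↪ Cross_m × Cross_{m+2}` must invent).  Exact layer (refuters, 2026-08-15):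
holds with `N = 1` for (2,1) m ≤ 12, (3,1),(4,1) m ≤ 10, (3,2) m ≤ 6, (5,2) m ≤ 5, (4,3) m ≤ 4,
(5,3),(5,4) m ≤ 3. -/
protected theorem Holds.stub_countingLogConvex : let E : ℕ → ℕ → Finset (Sym2 (Literature.Probability.LatticeModels.Site 2)) := fun M N ↦ ((Literature.Probability.Percolation.rectangle M N ×ˢ Literature.Probability.Percolation.rectangle M N).filter (fun xy ↦ (Literature.Probability.LatticeModels.zdGraph 2).Adj xy.1 xy.2)).image (fun xy ↦ s(xy.1, xy.2)); let C : ℕ → ℕ → ℕ := fun M N ↦ ((E M N).powerset.filter (fun ω ↦ ((ω : Set (Sym2 (Literature.Probability.LatticeModels.Site 2))) ∈ Literature.Probability.Percolation.lrCrossing M N))).card; ∀ p q : ℕ, 1 ≤ q → q < p → ∃ N : ℕ, ∀ m : ℕ, N ≤ m → 2 ^ (4 * p * q) * C (p * (m + 1)) (q * (m + 1) - 1) ^ 2 ≤ C (p * m) (q * m - 1) * C (p * (m + 2)) (q * (m + 2) - 1) := by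
  sorry

/-- By-name handle of the registered stub `Holds.stub_countingLogConvex`. -/
def stub_countingLogConvex : Prop := type_of% Holds.stub_countingLogConvex

/-! ### Sorry-free arithmetic used by the composition -/

/-- The exponent identity: along the hard-way family `(M,N) = (p·m, q·m − 1)` the box edge count
`2MN + M + N` has second difference exactly `4pq` in `m` (honest once `q·m ≥ 1`). -/
theorem edgeExp_second_diff (p q m : ℕ) (hqm : 1 ≤ q * m) :
    (2 * (p * m) * (q * m - 1) + p * m + (q * m - 1)) +
        (2 * (p * (m + 2)) * (q * (m + 2) - 1) + p * (m + 2) + (q * (m + 2) - 1)) =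
      2 * (2 * (p * (m + 1)) * (q * (m + 1) - 1) + p * (m + 1) + (q * (m + 1) - 1)) + 4 * p * q := by
  obtain ⟨n, hn⟩ : ∃ n : ℕ, q * m = n + 1 := ⟨q * m - 1, by omega⟩
  have h1 : q * (m + 1) - 1 = n + q := by rw [mul_add, mul_one]; omega
  have h2 : q * (m + 2) - 1 = n + 2 * q := by rw [mul_add]; omega
  have h0 : q * m - 1 = n := by omega
  rw [h1, h2, h0]
  ring

/-- The arithmetic of log-convexity for dyadic rationals: `2^k·C₁² ≤ C₀·C₂` and `e₀ + e₂ = 2e₁ + k`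
give `(C₁/2^{e₁})² ≤ (C₀/2^{e₀})·(C₂/2^{e₂})`. -/
theorem sq_div_le_of_counts {C0 C1 C2 e0 e1 e2 k : ℕ} (he : e0 + e2 = 2 * e1 + k)
    (hkey : 2 ^ k * C1 ^ 2 ≤ C0 * C2) :
    ((C1 : ℝ) / 2 ^ e1) ^ 2 ≤ (C0 : ℝ) / 2 ^ e0 * ((C2 : ℝ) / 2 ^ e2) := by
  have hkey' : (2 : ℝ) ^ k * (C1 : ℝ) ^ 2 ≤ (C0 : ℝ) * (C2 : ℝ) := by exact_mod_cast hkey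
  have hpos1 : (0 : ℝ) < (2 : ℝ) ^ (2 * e1) := by positivity
  rw [div_pow, div_mul_div_comm, ← pow_mul, ← pow_add, he,
    div_le_div_iff₀ (by positivity) (by positivity), pow_add, mul_comm e1 2]
  calc (C1 : ℝ) ^ 2 * ((2 : ℝ) ^ (2 * e1) * 2 ^ k)
      = (2 ^ k * (C1 : ℝ) ^ 2) * 2 ^ (2 * e1) := by ring
    _ ≤ ((C0 : ℝ) * C2) * 2 ^ (2 * e1) := mul_le_mul_of_nonneg_right hkey' hpos1.le

/-! ### Composition (sorry-free): the three stubs imply the crux BY NAME -/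

/-- **`LogConvexApproach` from the three stubs (real proof).** For `m ≥ N + 1` (so that `q·m ≥ 1`
and the heart applies) rewrite the three crossing probabilities as dyadic rationals (stub 2), their
exponents as `2MN + M + N` (stub 1), and conclude by `edgeExp_second_diff` + `sq_div_le_of_counts`
from the counting inequality (stub 3). -/
theorem LogConvexApproach_of (hE : stub_boxEdgeCard) (hD : stub_dyadicCount)
    (hC : stub_countingLogConvex) : LogConvexApproach := by
  dsimp only [stub_boxEdgeCard, stub_dyadicCount, stub_countingLogConvex] at hE hD hC
  intro p q hq hpq
  obtain ⟨N, hN⟩ := hC p q hq hpq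
  refine ⟨N + 1, fun m hm => ?_⟩
  have hNm : N ≤ m := by omega
  have hm1 : 1 ≤ m := by omega
  have hqm : 1 ≤ q * m := by
    have h := Nat.mul_le_mul hq hm1
    simpa using h
  have key := hN m hNm
  rw [hD (p * (m + 1)) (q * (m + 1) - 1), hD (p * m) (q * m - 1), hD (p * (m + 2)) (q * (m + 2) - 1),
    hE, hE, hE]
  exact sq_div_le_of_counts (edgeExp_second_diff p q m hqm) key

/-- **The crux BY NAME from the three stubs** (depends on `sorryAx` ONLY through the three
`Holds.stub_*`; this line also certifies that the by-name handles ARE the stub statements). -/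
theorem LogConvexApproach_proof : LogConvexApproach :=
  LogConvexApproach_of Holds.stub_boxEdgeCard Holds.stub_dyadicCount Holds.stub_countingLogConvex

end Summit.CriticalPhenomena.CardyFormulaZ2.Cruxes.LogConvexApproach.Birth

end
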